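import Summits.HodgeConjecture.HodgeConjecture.Theorems.Ring2AbelianAllAndreDominatedPencils
import Literature.AlgebraicGeometry.Motives.AbelianVarietyIsoOfScheme
import Literature.AlgebraicGeometry.Motives.JacobianAlbanese
import Literature.AlgebraicGeometry.Motives.AbelianVarietyKernelDimension
import Literature.AlgebraicGeometry.Milne1999.CMTypeSubquotients
import Literature.AlgebraicGeometry.Milne1999.CMTypeSimpleIsogenyFactors
import HarnessLib

/-!
# Ring 2 · sub-cell AbelianAll (ALL ABELIAN VARIETIES), André axis, part XXXIV-b — ISOGENOUS PENCILS HAVE THE SAME CM LOCUS: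
# a surjective `S`-morphism `ψ : 𝒳 ⟶ 𝒳'` of compact pencils of abelian varieties of the same relative dimension `d` gives
# `cmLocus (ψ ≫ f') d = cmLocus f' d` — rigidity (a morphism of abelian varieties is a translate of a homomorphism) makes the
# fibre map `ψ_t` an isogeny up to translation, and CM type is an isogeny invariant — FACT-FREE

HONEST FRAMING (page 1, verbatim): **research route, not a corollary; conditional on HC_CM plus one named
minimal statement.** Cell line: research route conditional on HC_CM; not a corollary; Q11.4-sentence-2 already
refuted in dim ≥ 3. Nothing in this file proves a case of the Hodge conjecture for an abelian variety; `HC_CM`, `HC_AV`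
do not occur; no node is born (0 `def`), no named fact is used, no `sorry`; axioms standard; nothing is claimed minimal.

## What this part does (the owed item (o96) of the seat's hand-over; complement of parts XXXIII-e / XXXIV-a)

Parts XXXIII-e (descent) and XXXIV-a (ascent) make transport and the lift of the pencils `ψ ≫ f'` and `f'` the SAME
statements point by point, for a surjective `S`-morphism `ψ` of compact abelian pencils of the same relative dimension.
The cell's nodes `(L) CMFibreAlgebraicLift`, `(4) CMAnchoredTransport`, `(3) CMPointedPencilVHC` quantify over the CM
POINTS of the pencil (`Deligne1982.cmLocus f d`); this file shows the two pencils have the same CM points, so that the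
CM-pointed forms agree as well (part XXXIV-c draws the rows).

* §1 `exists_hom_toSchemeHom_surjective` — RIGIDITY: a surjective morphism `g : A.X ⟶ A'.X` of the underlying varieties
  of two complex abelian varieties is, after the translation of `A'` by `−g(0)`, a surjective HOMOMORPHISM `A ⟶ A'`
  (the tree's `AbelianVariety.homOfOneComp` = Milne AV Cor. 2.2 via the rigidity lemma `isMonHom_of_one_comp`, and
  `one_comp_comp_translation_inv`); `exists_isIsogeny_of_schemeHom_of_dim_eq` — if moreover `dim A = dim A'` it is an
  ISOGENY (`isIsogeny_of_surjective_of_dim_eq`); `isOfCMType_iff_of_schemeHom_of_dim_eq` — so `A` is of CM type iff `A'`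
  is (`IsOfCMType.of_surjective_hom`, `IsOfCMType.of_isIsogeny'`).
* §2 for compact pencils of abelian varieties `ψ ≫ f'`, `f'` of the same relative dimension `d` and `ψ` surjective:
  the fibre map `ψ_t : 𝒳_t ⟶ 𝒳'_t` is surjective (XXXIII-e `surjective_fiberOverMap_left`) between varieties underlying
  abelian varieties of dimension `d` (the pencils' charts, `compactPencil_dim_eq_of_iso`), so §1 applies through the
  charts: `mem_cmLocus_of_mem_cmLocus_comp`, `mem_cmLocus_comp_of_mem_cmLocus`, **`cmLocus_comp_eq`**:
  `cmLocus (ψ ≫ f') d = cmLocus f' d`; in particular `(cmLocus (ψ ≫ f') d).Nonempty ↔ (cmLocus f' d).Nonempty`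
  (the CM-pointedness clause of node (3)).

What is NOT claimed: that `ψ_t` is a homomorphism for the group laws of the charts (only after a translation); anything
about the kernel of `ψ_t` or its degree; anything minimal; any case of HC. EDGE LABELS: every row K (kernel, fact-free).

References: Milne1986AbelianVarieties (§2 Cor. 2.2, Remark 2.3); MumfordAV1970 (§4 Cor. 1 of the rigidity lemma; §19 Thm. 1
and Remark p. 169); Milne1999 (§2 p. 54: CM type and isogenies / quotients); Deligne1982HodgeCycles (§5: CM type ⟺ Mumford–Tate
group a torus); LangeBirkenhake1992 (Prop. 1.1.12, Cor. 2.4.24); Andre1996Motifs (§6.3, proof of Lemme 6.3.1, p. 32: «bouger s ou t par G(ℚ) change X_s, X_t en des variétés abéliennes isogènes»); DeligneHodgeII1971 (proof of Lemme 4.4.16, p. 53: «remplaçant X par un schéma abélien isogène»); Andre1996Motifs (§6.3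
footnote (2)). [Locators revised after REFEREE-AB F-ab-138 / F-ab-142: §5.1 p. 25 of Andre1996Motifs concerns replacing the BASE `S` by a finite étale cover, not the abelian scheme by an isogenous one; the «schéma abélien isogène» sentence is Deligne's.]
-/

noncomputable section

set_option linter.dupNamespace false

namespace Summit.HodgeConjecture.HodgeConjecture.Ring2.AbelianAll

open CategoryTheory CategoryTheory.Limits AlgebraicGeometry MonoidalCategory CartesianMonoidalCategory
open Literature.AlgebraicGeometry Literature.AlgebraicGeometry.Motives
open Literature.AlgebraicGeometry.HodgeTheory
open Literature.AlgebraicGeometry.Deligne1982 (cmLocus)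
open Literature.AlgebraicGeometry.Milne1999 (IsOfCMType)

/-! ## §1 Rigidity: surjective morphisms of underlying varieties of abelian varieties -/

section Rigidity

variable {A A' : AbelianVariety ℂ}

/-- **A surjective morphism of the underlying varieties of two complex abelian varieties is a translate of a surjective
homomorphism**: `t_{−g(0)} ∘ g` preserves the origin (`one_comp_comp_translation_inv`), hence is a homomorphism by
rigidity (`homOfOneComp`, Milne AV Cor. 2.2), and it is surjective because `g` is and translations are automorphisms.
[cite: Milne1986AbelianVarieties, §2 Cor. 2.2 and Remark 2.3] [cite: MumfordAV1970, §4 Cor. 1] -/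
theorem exists_hom_toSchemeHom_surjective (g : A.X ⟶ A'.X) [Surjective g.left] :
    ∃ h : A ⟶ A', Surjective (AbelianVariety.Hom.toSchemeHom h) := by
  refine ⟨AbelianVariety.homOfOneComp (g ≫ A'.translation (AbelianVariety.originImage g)⁻¹)
    (AbelianVariety.one_comp_comp_translation_inv g), ?_⟩
  change Surjective (g ≫ A'.translation (AbelianVariety.originImage g)⁻¹).left
  rw [Over.comp_left]
  infer_instance

/-- If moreover `dim A = dim A'`, the homomorphism is an ISOGENY (surjective with finite kernel:
`isIsogeny_of_surjective_of_dim_eq`). [cite: MumfordAV1970, §19 Thm. 1 and Remark p. 169] [cite: LangeBirkenhake1992, Prop. 1.1.12] -/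
theorem exists_isIsogeny_of_schemeHom_of_dim_eq (g : A.X ⟶ A'.X) [Surjective g.left] (hdim : A.dim = A'.dim) :
    ∃ h : A ⟶ A', AbelianVariety.IsIsogeny h := by
  obtain ⟨h, hh⟩ := exists_hom_toSchemeHom_surjective g
  haveI := hh
  exact ⟨h, AbelianVariety.isIsogeny_of_surjective_of_dim_eq h hdim⟩

/-- **CM type is invariant under surjective morphisms of underlying varieties of the same dimension**: with `g : A.X ⟶ A'.X`
surjective and `dim A = dim A'`, `A` is of CM type iff `A'` is (`⟹`: quotients of CM abelian varieties are CM,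
`IsOfCMType.of_surjective_hom`; `⟸`: §1's isogeny and `IsOfCMType.of_isIsogeny'`). [cite: Milne1999, §2 p. 54]
[cite: MumfordAV1970, §19 Thm. 1 and Remark p. 169] [cite: Deligne1982HodgeCycles, §5 p. 63] -/
theorem isOfCMType_iff_of_schemeHom_of_dim_eq (g : A.X ⟶ A'.X) [Surjective g.left] (hdim : A.dim = A'.dim) :
    IsOfCMType A ↔ IsOfCMType A' := by
  obtain ⟨h, hh⟩ := exists_hom_toSchemeHom_surjective g
  haveI := hh
  exact ⟨fun hA ↦ hA.of_surjective_hom h,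
    fun hA' ↦ Literature.AlgebraicGeometry.Milne1999.IsOfCMType.of_isIsogeny'
      (AbelianVariety.isIsogeny_of_surjective_of_dim_eq h hdim) hA'⟩

end Rigidity

/-! ## §2 The CM locus of a pencil is invariant under surjective `S`-morphisms of pencils of the same relative dimension -/

section Pencils

variable {𝒳 𝒳' S : SchemeOver ℂ} {d : ℕ} {f' : 𝒳' ⟶ S} {ψ : 𝒳 ⟶ 𝒳'}
  (hf : IsCompactAbelianPencil (ψ ≫ f') d) (hf' : IsCompactAbelianPencil f' d)

variable [Surjective ψ.left]

include hf hf' in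
/-- Through charts `e : A.X ≅ 𝒳_t`, `e' : A'.X ≅ 𝒳'_t` of the two fibres at `t`, the fibre map gives a SURJECTIVE morphism
`e ≫ ψ_t ≫ e'⁻¹ : A.X ⟶ A'.X` of varieties underlying abelian varieties of the same dimension `d`, so `A` is of CM type iff
`A'` is (§1). [cite: Milne1999, §2 p. 54] [cite: Andre1996Motifs, §6.3 footnote (2)] -/
theorem isOfCMType_iff_of_fiber_charts (t : ComplexPoints S) {A A' : AbelianVariety ℂ} (e : A.X ≅ fiberOver (ψ ≫ f') t)
    (e' : A'.X ≅ fiberOver f' t) : IsOfCMType A ↔ IsOfCMType A' := by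
  haveI := surjective_fiberOverMap_left f' ψ t
  haveI : Surjective (e.hom ≫ fiberOverMap ψ f' t ≫ e'.inv).left := by
    haveI : IsIso e.hom.left := ((Over.forget _).mapIso e).isIso_hom
    haveI : IsIso e'.inv.left := ((Over.forget _).mapIso e'.symm).isIso_hom
    rw [Over.comp_left, Over.comp_left]
    infer_instance
  exact isOfCMType_iff_of_schemeHom_of_dim_eq (e.hom ≫ fiberOverMap ψ f' t ≫ e'.inv)
    ((Andre1996.compactPencil_dim_eq_of_iso hf e).trans (Andre1996.compactPencil_dim_eq_of_iso hf' e').symm)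

include hf hf' in
/-- A CM point of `ψ ≫ f'` is a CM point of `f'`: the fibre `𝒳'_t` is an abelian variety of dimension `d` (chart of the
pencil `f'`) onto which the CM fibre `𝒳_t` maps, hence of CM type. [cite: Milne1999, §2 p. 54]
[cite: Deligne1982HodgeCycles, §6 proof of Prop. 6.1 (p. 73)] -/
theorem mem_cmLocus_of_mem_cmLocus_comp {t : ComplexPoints S} (ht : t ∈ cmLocus (ψ ≫ f') d) : t ∈ cmLocus f' d := by
  obtain ⟨A₀, ⟨e₀⟩, -, hA₀⟩ := ht
  obtain ⟨A', ⟨e'⟩⟩ := hf'.exists_abelianVariety_fiber t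
  exact ⟨A', ⟨e'⟩, Andre1996.compactPencil_dim_eq_of_iso hf' e', (isOfCMType_iff_of_fiber_charts hf hf' t e₀ e').1 hA₀⟩

include hf hf' in
/-- A CM point of `f'` is a CM point of `ψ ≫ f'`: the fibre `𝒳_t` is an abelian variety of dimension `d` (chart of the
pencil `ψ ≫ f'`) mapping onto the CM fibre `𝒳'_t` of the same dimension, hence isogenous to it, hence of CM type.
[cite: Milne1999, §2 p. 54] [cite: MumfordAV1970, §19 Thm. 1 and Remark p. 169] -/
theorem mem_cmLocus_comp_of_mem_cmLocus {t : ComplexPoints S} (ht : t ∈ cmLocus f' d) : t ∈ cmLocus (ψ ≫ f') d := by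
  obtain ⟨A₁, ⟨e₁⟩, -, hA₁⟩ := ht
  obtain ⟨A, ⟨e⟩⟩ := hf.exists_abelianVariety_fiber t
  exact ⟨A, ⟨e⟩, Andre1996.compactPencil_dim_eq_of_iso hf e, (isOfCMType_iff_of_fiber_charts hf hf' t e e₁).2 hA₁⟩

include hf hf' in
/-- **ISOGENOUS PENCILS HAVE THE SAME CM LOCUS**: `cmLocus (ψ ≫ f') d = cmLocus f' d` for a surjective `S`-morphism `ψ` of
compact pencils of abelian varieties of the same relative dimension `d`. FACT-FREE. [cite: Milne1999, §2 p. 54]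
[cite: Andre1996Motifs, §6.3 proof of Lemme 6.3.1 (p. 32)] [cite: Deligne1982HodgeCycles, §5 p. 63] -/
theorem cmLocus_comp_eq : cmLocus (ψ ≫ f') d = cmLocus f' d :=
  Set.ext fun _ ↦ ⟨mem_cmLocus_of_mem_cmLocus_comp hf hf', mem_cmLocus_comp_of_mem_cmLocus hf hf'⟩

include hf hf' in
/-- In particular `ψ ≫ f'` is CM-pointed iff `f'` is (the hypothesis of node (3) `CMPointedPencilVHC`). [cite: Andre1996Motifs, Lemme 6.3.1 (ii) (p. 31)] -/
theorem cmLocus_comp_nonempty_iff : (cmLocus (ψ ≫ f') d).Nonempty ↔ (cmLocus f' d).Nonempty := by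
  rw [cmLocus_comp_eq hf hf']

end Pencils

end Summit.HodgeConjecture.HodgeConjecture.Ring2.AbelianAll

end
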